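import Literature.NumberTheory.LFunctions.WeilZeroSum

/-!
# The second un-excluded proof shape, typed: a Künneth tower implies RH, and each level is a quasi-RH (solo-informed, T54)

Deligne's proof of the Riemann Hypothesis for a variety `X/𝔽_q` (Weil I, 1974) ends with the
tensor-power squeeze: an a-priori bound with a CONSTANT loss — eigenvalues of Frobenius on
`Hⁿ(X)` have `|α| ≤ q^{n/2 + 1/2}`, the extra `q^{1/2}` coming from the absolute convergence of an
Euler product over the closed points of a base CURVE — is applied to `X^k`, whose middle cohomology
contains `α^k` by the Künneth formula; `|α^k| ≤ q^{kn/2 + 1/2}` for every `k` forces `|α| ≤ q^{n/2}`.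
The solo-informed census (`breaks.md`, synthesis item 3) records this — "a rigidity from a family that
does not exist yet (F20/F12: a Frobenius substitute)" — as the second of the two proof shapes for `ζ`
that no theorem excludes, the first (Riemann–Roch ⟹ Hodge index ⟹ Weil positivity) being typed in
`SoloInformedWeilSurface`.

This file types the second shape against the tree's set of non-trivial zeros
`ZetaZeros.riemannZetaNontrivialZeros` and proves, in the kernel, exactly what it is worth.
In the dictionary `Spec ℤ ↔ C/𝔽₁`, "eigenvalue `α` of weight `w`" ↔ "zero `ρ` with `2 Re ρ = w`",
the `k`-th power `C^k = Spec ℤ ×_{𝔽₁} ⋯ ×_{𝔽₁} Spec ℤ` should carry a zeta function whose zeros contain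
the sums `ρ₁ + ⋯ + ρ_k` (Künneth; Kurokawa's tensor products, Manin 1995) and which has an Euler
product / Dirichlet series with non-negative coefficients to the right of `Re s = k/2 + C` with `C`
INDEPENDENT of `k` (the base curve).  `KunnethLevel k C` is that statement with the carrier abstracted
to a set `Z ⊆ ℂ`:  (Euler) `Re z ≤ k/2 + C` on `Z`;  (Künneth) `ρ₁ + ⋯ + ρ_k ∈ Z` for all non-trivial
zeros `ρ_i` of `ζ`.

Results (all elementary).
* `riemannHypothesis_of_kunnethTower`: `(∀ k ≥ 1, KunnethLevel k C) → RiemannHypothesis` — the squeeze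
  (`Re ρ ≤ 1/2 + C/k` for every `k`), then the symmetry `ρ ↦ 1 - ρ̄` (`quasiRiemannHypothesis_one_half_iff`).
* `kunnethLevel_one`: level `1` with `C = 1/2` HOLDS — it is the non-vanishing of `ζ` on `Re s ≥ 1`
  (Mathlib `riemannZeta_ne_zero_of_one_le_re`, Hadamard–de la Vallée Poussin), i.e. the Euler-product
  step of the dictionary is a theorem for `ζ` itself.
* `kunnethLevel_iff`: for `k ≥ 1`, `KunnethLevel k C ↔ ∀ ρ ∈ nontrivial zeros, Re ρ ≤ 1/2 + C/k` — the
  carrier is eliminable, so LEVEL `k` IS VERBATIM THE CLOSED QUASI-RIEMANN HYPOTHESIS AT `1/2 + C/k`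
  (`quasiRiemannHypothesis_of_kunnethLevel`: it gives the tree's `QuasiRiemannHypothesis (1/2 + C/k)`),
  and all levels are one statement up to rescaling `C` (`kunnethLevel_iff_kunnethLevel`).  In
  particular the square alone (`k = 2`, `C = 1/2`) is "`ζ(s) ≠ 0` for `Re s > 3/4`".
* `riemannHypothesis_iff_kunnethTower`, `riemannHypothesis_iff_exists_kunnethTower`: conversely RH
  gives every level with `C = 0`; so the tower is RH-equivalent and, unlike the Riemann–Roch interface
  (whose axiom list is RH-equivalent but needs a model for its consistency), it has NO axiom short of
  its conclusion at each level: the content of shape (2) is entirely the ENGINE — an honest `k`-th power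
  object whose Euler bound is proved by absolute convergence and positivity, not read off the zeros.

Reading (recorded in the solo-informed deliverable, `sharpest.md` §2g).  Shape (2) is a LADDER whose
rungs `1/2 + C/k`, `k = 1, 2, 3, …` are quasi-Riemann hypotheses; rung `1` is a theorem (this file),
no rung `k ≥ 2` is (any zero-free half-plane `Re s > σ₀`, `σ₀ < 1`, is open); the margin-wall ladders
of the census have every rung proved and the limit unproved, the Riemann–Roch shape has no rungs at
all.  Both un-excluded shapes ask for the same missing object — the arithmetic powers
`Spec ℤ ×_{𝔽₁} ⋯ ×_{𝔽₁} Spec ℤ` — through different functors (`Pic`, `H⁰`, Riemann–Roch for (1);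
point counts, Künneth, Euler positivity for (2)); the number-field shadows of Deligne's other two steps
exist and are RH-blind: the Rankin–Selberg positivity squeeze acts on LOCAL parameters (Ramanujan
from functoriality, F20), and the Euler-product step is level `1` (`Re ρ ≤ 1`, F1).

Honest grade: reformulation; the mathematics is the Archimedean property.  New only as the kernel
typing that completes the census' two un-excluded shapes, with the carrier-elimination remark.

References (`[v]` = page verified in the held corpus, `[m]` = section numbers cited from memory):
P. Deligne, *La conjecture de Weil. I*, Publ. Math. IHÉS 43 (1974) 273–307, (1.6)–(1.7), §3, §7 [m];
R. Kiehl, R. Weissauer, *Weil Conjectures, Perverse Sheaves and l-adic Fourier Transform*, Springer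
(2001), Lemma I.4.2 ("Rankin–Selberg method"), pp. 64–65 [v]; N. Katz, *An overview of Deligne's
proof of the Riemann hypothesis for varieties over finite fields*, Proc. Symp. Pure Math. 28 (1976)
[m]; Yu. I. Manin, *Lectures on zeta functions and motives (according to Deninger and Kurokawa)*,
Astérisque 228 (1995) §1.7, §2.5 [m]; N. Kurokawa, *Multiple zeta functions: an example*, Adv. Stud.
Pure Math. 21 (1992) [m]; H. Iwaniec, E. Kowalski, *Analytic Number Theory*, AMS Coll. Publ. 53,
§5.7 (quasi-RH) [m].
-/

noncomputable section

open Complex Set Finset Literature.NumberTheory.LFunctions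
open Literature.NumberTheory.LFunctions.ZetaZeros

namespace Summit.RiemannHypothesis.RiemannHypothesis.Theorems

/-! ## The squeeze -/

/-- The tensor-power squeeze in its bare form: a real number `η` with `k • η ≤ C` for every
`k ≥ 1` is `≤ 0` (Archimedean property).  Deligne, Weil I (1.6)/(7.1): "`|α^k| ≤ q^{kn/2 + 1/2}` pour
tout `k`, donc `|α| ≤ q^{n/2}`". [folklore] -/
theorem nonpos_of_forall_nat_mul_le {η C : ℝ} (h : ∀ k : ℕ, 1 ≤ k → (k : ℝ) * η ≤ C) : η ≤ 0 := by
  by_contra hη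
  rw [not_le] at hη
  obtain ⟨k, hk⟩ := exists_nat_gt (max (C / η) 1)
  have hk1 : (1 : ℝ) ≤ k := ((le_max_right _ _).trans_lt hk).le
  have hkC : C / η < k := (le_max_left _ _).trans_lt hk
  have : C < (k : ℝ) * η := by rwa [div_lt_iff₀ hη] at hkC
  exact absurd (h k (by exact_mod_cast hk1)) (not_le.2 this)

/-! ## Künneth levels -/

/-- **Level `k` of a Künneth tower with Euler barrier `C`.**  A set `Z ⊆ ℂ` — "the zeros of the zeta
function of the `k`-th arithmetic power of `Spec ℤ`", in coordinates whose critical line is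
`Re s = k/2` — with (Euler) `Re z ≤ k/2 + C` for `z ∈ Z` (absolute convergence of its Euler product /
positivity of its Dirichlet coefficients to the right of that line, the loss `C` coming from the base,
not from `k`) and (Künneth) `ρ₁ + ⋯ + ρ_k ∈ Z` for every `k`-tuple of non-trivial zeros of `ζ`.
The carrier `Z` is posited, never constructed: see `kunnethLevel_iff` for what the axiom pair is
logically worth. [folklore] -/
def KunnethLevel (k : ℕ) (C : ℝ) : Prop :=
  ∃ Z : Set ℂ, (∀ z ∈ Z, z.re ≤ k / 2 + C) ∧
    ∀ ρ : Fin k → ℂ, (∀ i, ρ i ∈ riemannZetaNontrivialZeros) → ∑ i, ρ i ∈ Z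

variable {k : ℕ} {C C' : ℝ}

/-- **Carrier elimination.**  For `k ≥ 1`, level `k` with barrier `C` says exactly that every
non-trivial zero has `Re ρ ≤ 1/2 + C/k`: (⟹) apply Künneth to the constant tuple `(ρ, …, ρ)`;
(⟸) take `Z = {z | Re z ≤ k/2 + C}`.  So a Künneth level is the closed quasi-Riemann hypothesis at
abscissa `1/2 + C/k`, nothing more and nothing less. [folklore] -/
theorem kunnethLevel_iff (hk : 1 ≤ k) :
    KunnethLevel k C ↔ ∀ ρ ∈ riemannZetaNontrivialZeros, ρ.re ≤ 1 / 2 + C / k := by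
  have hk0 : (0 : ℝ) < k := by exact_mod_cast hk
  constructor
  · rintro ⟨Z, hZ, hK⟩ ρ hρ
    have hmem := hK (fun _ : Fin k ↦ ρ) fun _ ↦ hρ
    have hre := hZ _ hmem
    rw [Finset.sum_const, Finset.card_univ, Fintype.card_fin, re_nsmul, nsmul_eq_mul] at hre
    rw [← mul_le_mul_iff_of_pos_left hk0]
    have : (k : ℝ) * (1 / 2 + C / k) = k / 2 + C := by field_simp
    linarith
  · intro h
    refine ⟨{z | z.re ≤ k / 2 + C}, fun z hz ↦ hz, fun ρ hρ ↦ ?_⟩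
    show (∑ i, ρ i).re ≤ k / 2 + C
    rw [re_sum]
    calc ∑ i, (ρ i).re ≤ ∑ _i : Fin k, (1 / 2 + C / k) := Finset.sum_le_sum fun i _ ↦ h _ (hρ i)
      _ = k / 2 + C := by
        rw [Finset.sum_const, Finset.card_univ, Fintype.card_fin, nsmul_eq_mul]; field_simp

/-- Levels are monotone in the barrier. [folklore] -/
theorem KunnethLevel.mono (h : KunnethLevel k C) (hC : C ≤ C') : KunnethLevel k C' := by
  obtain ⟨Z, hZ, hK⟩ := h
  exact ⟨Z, fun z hz ↦ (hZ z hz).trans (by linarith), hK⟩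

/-- All levels are ONE statement up to rescaling the barrier: level `k` with barrier `C` is level `j`
with barrier `j C / k` (`j, k ≥ 1`).  The tower's whole content is the single real number
`inf_k C_k / k`. [folklore] -/
theorem kunnethLevel_iff_kunnethLevel {j : ℕ} (hj : 1 ≤ j) (hk : 1 ≤ k) :
    KunnethLevel k C ↔ KunnethLevel j (j * C / k) := by
  rw [kunnethLevel_iff hk, kunnethLevel_iff hj]
  have hj0 : (j : ℝ) ≠ 0 := by exact_mod_cast (Nat.one_le_iff_ne_zero.1 hj)
  have : (j : ℝ) * C / k / j = C / k := by field_simp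
  rw [this]

/-- **Rung 1 is a theorem.**  Level `1` with barrier `C = 1/2` holds: it says `Re ρ ≤ 1` for the
non-trivial zeros, i.e. the non-vanishing of `ζ` on `Re s ≥ 1` (Mathlib `riemannZeta_ne_zero_of_one_le_re`,
Hadamard–de la Vallée Poussin 1896), which is what `ZetaZeros.riemannZetaNontrivialZeros.re_lt_one`
packages.  In the dictionary this is Deligne's Euler-product step "weights of `H¹_c` are `≤ w + 2`".
[folklore] -/
theorem kunnethLevel_one : KunnethLevel 1 (1 / 2) :=
  (kunnethLevel_iff le_rfl).2 fun _ hρ ↦ by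
    norm_num; exact (riemannZetaNontrivialZeros.re_lt_one hρ).le

/-- Rung `k` is the quasi-Riemann hypothesis at `1/2 + C/k` (tree `QuasiRiemannHypothesis σ₀`: no
zeros with `σ₀ < Re s < 1`), for a barrier `C ≥ 0`.  With `k = 2`, `C = 1/2`: a Künneth SQUARE with the
Euler-product loss is "`ζ(s) ≠ 0` for `Re s > 3/4`"; no level `k ≥ 2` is known for any `C < k/2`.
Iwaniec–Kowalski §5.7. [folklore] -/
theorem quasiRiemannHypothesis_of_kunnethLevel (hk : 1 ≤ k) (hC : 0 ≤ C) (h : KunnethLevel k C) :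
    QuasiRiemannHypothesis (1 / 2 + C / k) := by
  intro s hs h0 h1
  have hk0 : (0 : ℝ) < k := by exact_mod_cast hk
  have hσ : (0 : ℝ) < 1 / 2 + C / k := by positivity
  have hmem : s ∈ riemannZetaNontrivialZeros :=
    riemannZetaNontrivialZeros.mem_of_re_pos hs (hσ.trans h0)
  exact absurd ((kunnethLevel_iff hk).1 h s hmem) (not_le.2 h0)

/-! ## The tower and the Riemann Hypothesis -/

/-- **A Künneth tower implies the Riemann Hypothesis.**  If every level `k ≥ 1` holds with one and the
same barrier `C` (any real `C`), then `k (Re ρ - 1/2) ≤ C` for all `k`, so `Re ρ ≤ 1/2` for every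
non-trivial zero (`nonpos_of_forall_nat_mul_le`); the symmetry `ρ ↦ 1 - ρ̄` of the non-trivial zeros
(functional equation; tree `quasiRiemannHypothesis_one_half_iff_holds`) gives `Re ρ = 1/2`.
Deligne, Weil I §7, transposed along `Spec ℤ ↔ C/𝔽₁`. [folklore] -/
theorem riemannHypothesis_of_kunnethTower (h : ∀ k : ℕ, 1 ≤ k → KunnethLevel k C) :
    RiemannHypothesis := by
  have hle : ∀ ρ ∈ riemannZetaNontrivialZeros, ρ.re ≤ 1 / 2 := by
    intro ρ hρ
    have : ρ.re - 1 / 2 ≤ 0 := by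
      refine nonpos_of_forall_nat_mul_le (C := C) fun k hk ↦ ?_
      have hk0 : (0 : ℝ) < k := by exact_mod_cast hk
      have := (kunnethLevel_iff hk).1 (h k hk) ρ hρ
      have hkk : (k : ℝ) * (C / k) = C := by field_simp
      nlinarith
    linarith
  refine quasiRiemannHypothesis_one_half_iff_holds.1 fun s hs h0 h1 ↦ ?_
  have hmem : s ∈ riemannZetaNontrivialZeros :=
    riemannZetaNontrivialZeros.mem_of_re_pos hs (lt_trans (by norm_num) h0)
  exact absurd (hle s hmem) (not_le.2 h0)

/-- Conversely, under RH every level holds with barrier `C = 0` (`Z = {Re z ≤ k/2}`; every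
non-trivial zero has `Re ρ = 1/2`).  The converse triviality of shape (2). [folklore] -/
theorem kunnethLevel_of_riemannHypothesis (hRH : RiemannHypothesis) (k : ℕ) : KunnethLevel k 0 := by
  rcases Nat.eq_zero_or_pos k with rfl | hk
  · exact ⟨{z | z.re ≤ (0 : ℕ) / 2 + 0}, fun z hz ↦ hz, fun ρ _ ↦ by simp⟩
  · refine (kunnethLevel_iff hk).2 fun ρ hρ ↦ ?_
    have h := hRH ρ (riemannZetaNontrivialZeros.zeta_eq_zero hρ) ?_
      (riemannZetaNontrivialZeros.ne_one hρ)
    · rw [h]; simp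
    · rintro ⟨n, hn⟩
      have := riemannZetaNontrivialZeros.re_pos hρ
      rw [hn] at this
      simp only [mul_re, neg_re, re_ofNat, add_re, natCast_re, one_re, neg_im, im_ofNat, neg_zero,
        add_im, natCast_im, one_im, add_zero, mul_zero, sub_zero] at this
      linarith [n.cast_nonneg (α := ℝ)]

/-- **`RiemannHypothesis ↔` a Künneth tower with barrier `0`.** [folklore] -/
theorem riemannHypothesis_iff_kunnethTower :
    RiemannHypothesis ↔ ∀ k : ℕ, 1 ≤ k → KunnethLevel k 0 :=
  ⟨fun h k _ ↦ kunnethLevel_of_riemannHypothesis h k, fun h ↦ riemannHypothesis_of_kunnethTower h⟩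

/-- **`RiemannHypothesis ↔` a Künneth tower with SOME `k`-independent barrier** — the exact logical
worth of Deligne's shape for `ζ`: the loss may be any constant, but it must not grow with `k`.
[folklore] -/
theorem riemannHypothesis_iff_exists_kunnethTower :
    RiemannHypothesis ↔ ∃ C : ℝ, ∀ k : ℕ, 1 ≤ k → KunnethLevel k C :=
  ⟨fun h ↦ ⟨0, fun k _ ↦ kunnethLevel_of_riemannHypothesis h k⟩,
    fun ⟨_, h⟩ ↦ riemannHypothesis_of_kunnethTower h⟩

/-- What a barrier growing with `k` is worth: levels with `C_k = k/2` hold unconditionally (the open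
strip), so a tower whose loss is proportional to `k` — which is all the Euler product of `ζ(s)^k` or of
any product of shifted `ζ`'s and Dirichlet `L`-functions gives, their zeros being unions, not sums —
carries no information. [folklore] -/
theorem kunnethLevel_half_mul (k : ℕ) : KunnethLevel k (k / 2) := by
  rcases Nat.eq_zero_or_pos k with rfl | hk
  · exact ⟨{z | z.re ≤ (0 : ℕ) / 2 + (0 : ℕ) / 2}, fun z hz ↦ hz, fun ρ _ ↦ by simp⟩
  · refine (kunnethLevel_iff hk).2 fun ρ hρ ↦ ?_
    have hk0 : (k : ℝ) ≠ 0 := by exact_mod_cast hk.ne'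
    have : (k : ℝ) / 2 / k = 1 / 2 := by field_simp
    rw [this]
    linarith [riemannZetaNontrivialZeros.re_lt_one hρ]

end Summit.RiemannHypothesis.RiemannHypothesis.Theorems

end
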